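import Summits.QuantumFields.QCD.Theses.HeatSlicedQuarks
import Summits.QuantumFields.QCD.Theorems.HeatSlicedQuarksSmallFieldUltracontractivity
import Summits.QuantumFields.QCD.Theorems.HeatSlicedQuarksSmallFieldUltracontractivityStubHeatRowCalculus
import Summits.QuantumFields.QCD.Theorems.HeatSlicedQuarksSmallFieldUltracontractivityFixedPointA
import Summits.QuantumFields.QCD.Theorems.HeatSlicedQuarksInterleavedHeatSliceFlowStubFreeSmoothing
import Literature.MathematicalPhysics.QuantumLattice.OverlapLocality
import Mathlib.Analysis.CStarAlgebra.Matrix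

/-!
# Helpers for stub `stub_columnIdentification` of line `Sketch` (crux `InterleavedHeatSliceFlow`, item stmt-QuantumFields-8891)

Generic `ℓ²` facts about the heat semigroup `K(σ) = exp(-σ AᴴA)` of a complex square matrix `A`, acting on
COLUMN vectors (`Matrix.mulVec`), used by the column Duhamel of `stub_columnIdentification`:

* `exp_conjTranspose_mul_self_mul_conjTranspose` — the intertwining `exp(-σAᴴA) Aᴴ = Aᴴ exp(-σAAᴴ)`;
* `adjoint_smoothing` — `‖exp(-σAᴴA) Aᴴ u‖₂² ≤ (2eσ)⁻¹ ‖u‖₂²` (`σ > 0`), from the landed `stub_freeSmoothing`;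
* `heat_mulVec_contraction` — `‖exp(-σAᴴA) u‖₂ ≤ ‖u‖₂` (`σ ≥ 0`), from 8871's `stub_heatRowCalculus`;
* `sqrt_sum_norm_sq_mulVec_le_of_col_le` — `‖K u‖₂ ≤ (sup_q ‖col_q K‖₂) ‖u‖₁` (Minkowski over columns);
* `sum_norm_sq_col_eq_re_apply_self` — the T*T identity for COLUMNS, `Σ_i |K(σ)(i,q)|² = Re K(2σ)(q,q)`;
* `sum_norm_sq_conjTranspose_wilsonDirac_mulVec_le` — `‖D_Wᴴ u‖₂² ≤ 81 ‖u‖₂²` for `m ∈ [-1/2,1]` (HJL (2.14));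
* `combined_smoothing` — the two bounds for `exp(-σ D_Wᴴ D_W) D_Wᴴ` merged into ONE profile
  `9√2/√(1 + 162 e σ)` valid and continuous for all `σ ≥ 0`.

All statements are finite-dimensional linear algebra; no named facts are used.
-/

noncomputable section

namespace Summit.QuantumFields.QCD.Cruxes.InterleavedHeatSliceFlow.Sketch

open Literature.MathematicalPhysics.QuantumLattice Literature.MathematicalPhysics.QuantumFieldTheory
  Literature.Probability.LatticeModels
open Summit.QuantumFields.QCD.Theses.HeatSlicedQuarks
open Summit.QuantumFields.QCD.Theorems.SmallFieldUltracontractivity.Negative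
open Summit.QuantumFields.QCD.Cruxes.SmallFieldUltracontractivity.PointCentredAxialParabolic
open scoped Matrix ComplexConjugate

section Generic

variable {ι : Type} [Fintype ι] [DecidableEq ι]

/-- If a square matrix `P` intertwines two square matrices, `X P = P Y`, then it intertwines their exponentials:
`exp X · P = P · exp Y` (push `Z ↦ Z P` and `Z ↦ P Z` through the exponential series and use `Xⁿ P = P Yⁿ`).
(Adapted from the landed `stub_coveringPeriodization` file, where the rectangular version is private.) -/
theorem exp_mul_eq_mul_exp_of_comm (X Y P : Matrix ι ι ℂ) (h : X * P = P * Y) :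
    NormedSpace.exp X * P = P * NormedSpace.exp Y := by
  have hpow : ∀ k : ℕ, X ^ k * P = P * Y ^ k := fun k => by
    induction k with
    | zero => rw [pow_zero, pow_zero, Matrix.one_mul, Matrix.mul_one]
    | succ k ih =>
      rw [pow_succ, Matrix.mul_assoc, h, ← Matrix.mul_assoc, ih, Matrix.mul_assoc, ← pow_succ]
  let f : Matrix ι ι ℂ →+ Matrix ι ι ℂ := AddMonoidHom.mk' (fun Z => Z * P) fun Z Z' =>
    Matrix.add_mul Z Z' P
  let g : Matrix ι ι ℂ →+ Matrix ι ι ℂ := AddMonoidHom.mk' (fun Z => P * Z) fun Z Z' =>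
    Matrix.mul_add P Z Z'
  have hf : Continuous f := continuous_id.matrix_mul continuous_const
  have hg : Continuous g := continuous_const.matrix_mul continuous_id
  open scoped Matrix.Norms.Operator in
  have hX : HasSum (f ∘ fun k : ℕ => (k.factorial⁻¹ : ℂ) • X ^ k) (f (NormedSpace.exp X)) :=
    (NormedSpace.exp_series_hasSum_exp' (𝕂 := ℂ) X).map f hf
  open scoped Matrix.Norms.Operator in
  have hY : HasSum (g ∘ fun k : ℕ => (k.factorial⁻¹ : ℂ) • Y ^ k) (g (NormedSpace.exp Y)) :=
    (NormedSpace.exp_series_hasSum_exp' (𝕂 := ℂ) Y).map g hg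
  have hfg : (f ∘ fun k : ℕ => (k.factorial⁻¹ : ℂ) • X ^ k) =
      (g ∘ fun k : ℕ => (k.factorial⁻¹ : ℂ) • Y ^ k) := by
    funext k
    simp only [Function.comp_apply, f, g, AddMonoidHom.mk'_apply, Matrix.smul_mul, Matrix.mul_smul,
      hpow]
  rw [hfg] at hX
  exact hX.unique hY

/-- **Intertwining of the adjoint through the heat semigroup**: `exp(-σ AᴴA) Aᴴ = Aᴴ exp(-σ AAᴴ)`. -/
theorem exp_conjTranspose_mul_self_mul_conjTranspose (A : Matrix ι ι ℂ) (σ : ℝ) :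
    NormedSpace.exp (-(σ : ℂ) • (Aᴴ * A)) * Aᴴ = Aᴴ * NormedSpace.exp (-(σ : ℂ) • (A * Aᴴ)) := by
  refine exp_mul_eq_mul_exp_of_comm _ _ _ ?_
  rw [Matrix.smul_mul, Matrix.mul_smul, Matrix.mul_assoc]

/-- **Adjoint smoothing**: for `σ > 0` and every vector `u`, `‖exp(-σ AᴴA) Aᴴ u‖₂² ≤ (2eσ)⁻¹ ‖u‖₂²`
(the landed `stub_freeSmoothing` for the matrix `Aᴴ`, whose T*T semigroup is `exp(-σ AAᴴ)`, moved to the left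
by the intertwining identity). -/
theorem adjoint_smoothing (A : Matrix ι ι ℂ) {σ : ℝ} (hσ : 0 < σ) (u : ι → ℂ) :
    ∑ i, ‖((NormedSpace.exp (-(σ : ℂ) • (Aᴴ * A)) * Aᴴ).mulVec u) i‖ ^ 2 ≤
      (2 * Real.exp 1 * σ)⁻¹ * ∑ i, ‖u i‖ ^ 2 := by
  have h := stub_freeSmoothing ι Aᴴ σ hσ u
  rw [Matrix.conjTranspose_conjTranspose] at h
  rwa [exp_conjTranspose_mul_self_mul_conjTranspose]

omit [DecidableEq ι] in
/-- For a Hermitian matrix, applying it to a column vector is the conjugate of applying the conjugate ROW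
vector from the left: `(K u)_i = star (Σ_j (star u)_j K_{j i})`. -/
theorem mulVec_eq_star_sum_of_isHermitian {K : Matrix ι ι ℂ} (hK : K.IsHermitian) (u : ι → ℂ) (i : ι) :
    K.mulVec u i = star (∑ j, star (u j) * K j i) := by
  rw [Matrix.mulVec, dotProduct, star_sum]
  refine Finset.sum_congr rfl fun j _ => ?_
  rw [star_mul', star_star, mul_comm]
  congr 1
  conv_lhs => rw [← hK.eq]
  rw [Matrix.conjTranspose_apply]

/-- **Contraction on columns**: `‖exp(-σ AᴴA) u‖₂² ≤ ‖u‖₂²` for `σ ≥ 0` (8871's row contraction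
`stub_heatRowCalculus` (1) applied to the conjugate row, using that the heat kernel is Hermitian). -/
theorem heat_mulVec_contraction (A : Matrix ι ι ℂ) {σ : ℝ} (hσ : 0 ≤ σ) (u : ι → ℂ) :
    ∑ i, ‖(NormedSpace.exp (-(σ : ℂ) • (Aᴴ * A))).mulVec u i‖ ^ 2 ≤ ∑ i, ‖u i‖ ^ 2 := by
  have hK : (NormedSpace.exp (-(σ : ℂ) • (Aᴴ * A))).IsHermitian := isHermitian_exp_neg_smul A σ
  have h := stub_heatRowCalculus.1 ι A (star u) σ hσ
  have hl : ∀ i, ‖(NormedSpace.exp (-(σ : ℂ) • (Aᴴ * A))).mulVec u i‖ =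
      ‖∑ j, (star u) j * (NormedSpace.exp (-(σ : ℂ) • (Aᴴ * A))) j i‖ := fun i => by
    rw [mulVec_eq_star_sum_of_isHermitian hK, norm_star]
    rfl
  have hr : ∀ j, ‖(star u) j‖ = ‖u j‖ := fun j => by simp
  simp only [hl]
  simpa only [hr] using h

omit [DecidableEq ι] in
/-- **`ℓ¹ → ℓ²` bound by the largest column**: if every column of `K` has `ℓ²` norm at most `S`, then
`‖K u‖₂ ≤ S ‖u‖₁` (Minkowski: `K u = Σ_q u_q col_q`). -/
theorem sqrt_sum_norm_sq_mulVec_le_of_col_le (K : Matrix ι ι ℂ) {S : ℝ}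
    (hS : ∀ q, Real.sqrt (∑ i, ‖K i q‖ ^ 2) ≤ S) (u : ι → ℂ) :
    Real.sqrt (∑ i, ‖K.mulVec u i‖ ^ 2) ≤ S * ∑ q, ‖u q‖ := by
  have hrepr : ∀ i, K.mulVec u i = ∑ q, (fun q i => K i q * u q) q i := fun i => by
    simp [Matrix.mulVec, dotProduct]
  simp only [hrepr]
  refine (sqrt_sum_norm_sq_sum_le (Finset.univ : Finset ι) (fun q i => K i q * u q)).trans ?_
  rw [Finset.mul_sum]
  refine Finset.sum_le_sum fun q _ => ?_
  have hfac : ∑ i, ‖K i q * u q‖ ^ 2 = ‖u q‖ ^ 2 * ∑ i, ‖K i q‖ ^ 2 := by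
    rw [Finset.mul_sum]
    refine Finset.sum_congr rfl fun i _ => ?_
    rw [norm_mul]; ring
  rw [hfac, Real.sqrt_mul (sq_nonneg _), Real.sqrt_sq (norm_nonneg _), mul_comm]
  exact mul_le_mul_of_nonneg_right (hS q) (norm_nonneg _)

/-- **T*T for columns**: `Σ_i |exp(-σAᴴA)(i,q)|² = Re exp(-2σ AᴴA)(q,q)` (columns of the Hermitian heat kernel
are conjugate rows; then `exp_neg_smul_apply_self_eq_sum_norm_sq` at time `2σ`). -/
theorem sum_norm_sq_col_eq_re_apply_self (A : Matrix ι ι ℂ) (σ : ℝ) (q : ι) :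
    ∑ i, ‖(NormedSpace.exp (-(σ : ℂ) • (Aᴴ * A))) i q‖ ^ 2 =
      ((NormedSpace.exp (-((2 * σ : ℝ) : ℂ) • (Aᴴ * A))) q q).re := by
  have hK : (NormedSpace.exp (-(σ : ℂ) • (Aᴴ * A))).IsHermitian := isHermitian_exp_neg_smul A σ
  have hT := exp_neg_smul_apply_self_eq_sum_norm_sq A (2 * σ) q
  have h2 : (2 * σ / 2 : ℝ) = σ := by ring
  rw [h2] at hT
  rw [hT, Complex.re_sum]
  refine Finset.sum_congr rfl fun i _ => ?_
  rw [Complex.ofReal_re]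
  congr 1
  conv_rhs => rw [← hK.eq]
  rw [Matrix.conjTranspose_apply, norm_star]

end Generic

section Wilson

variable {L : ℕ} [NeZero L]

/-- **`‖D_Wᴴ u‖₂² ≤ 81 ‖u‖₂²`** for the `r = 1` Wilson–Dirac matrix at any gauge field and any mass `m ∈ [-1/2, 1]`
(HJL (2.14): `‖D_W‖ ≤ |m+4| + 4 ≤ 9` in the `ℓ²` operator norm, and `‖D_Wᴴ‖ = ‖D_W‖`). -/
theorem sum_norm_sq_conjTranspose_wilsonDirac_mulVec_le
    (U : GaugeConfig 4 L (Matrix.specialUnitaryGroup (Fin 3) ℂ)) {m : ℝ} (hm : m ∈ Set.Icc (-(1 / 2 : ℝ)) 1)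
    (u : TorusSite 4 L × Fin 3 × Fin 4 → ℂ) :
    ∑ i, ‖((wilsonDirac (fundamentalRep (Fin 3)) U m 1)ᴴ.mulVec u) i‖ ^ 2 ≤ 81 * ∑ i, ‖u i‖ ^ 2 := by
  open scoped Matrix.Norms.L2Operator in
  have h1 := sum_norm_sq_mulVec_le ((wilsonDirac (fundamentalRep (Fin 3)) U m 1)ᴴ) u
  open scoped Matrix.Norms.L2Operator in
  have h2 : ‖(wilsonDirac (fundamentalRep (Fin 3)) U m 1)ᴴ‖ ≤ 9 := by
    rw [Matrix.l2_opNorm_conjTranspose]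
    refine (l2_opNorm_wilsonDirac_le (fundamentalRep (Fin 3)) fundamentalRep_mem_unitaryGroup U m).trans ?_
    have hm4 : |m + 4| ≤ 5 := by rw [abs_le]; constructor <;> linarith [hm.1, hm.2]
    linarith
  open scoped Matrix.Norms.L2Operator in
  have h3 : ‖(wilsonDirac (fundamentalRep (Fin 3)) U m 1)ᴴ‖ ^ 2 ≤ 81 := by
    nlinarith [norm_nonneg ((wilsonDirac (fundamentalRep (Fin 3)) U m 1)ᴴ)]
  have h0 : 0 ≤ ∑ i, ‖u i‖ ^ 2 := Finset.sum_nonneg fun i _ => by positivity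
  exact h1.trans (mul_le_mul_of_nonneg_right h3 h0)

/-- The elementary inequality behind the merged smoothing profile: for `a ≥ 0`,
`min 9 (1/√(2ea))`-type bounds are dominated by `9√2/√(1 + 162 e a)`; here the two cases separately:
(1) if `162 e σ ≤ 1` then `9 ≤ 9√2/√(1+162eσ)`; (2) if `1 ≤ 162 e σ` then `1/√(2eσ) ≤ 9√2/√(1+162eσ)`. -/
theorem nine_le_profile {σ : ℝ} (hσ : 0 ≤ σ) (h : 162 * Real.exp 1 * σ ≤ 1) :
    (9 : ℝ) ≤ 9 * Real.sqrt 2 / Real.sqrt (1 + 162 * Real.exp 1 * σ) := by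
  have hpos : 0 < 1 + 162 * Real.exp 1 * σ := by positivity
  have hs : Real.sqrt (1 + 162 * Real.exp 1 * σ) ≤ Real.sqrt 2 :=
    Real.sqrt_le_sqrt (by linarith)
  have hspos : 0 < Real.sqrt (1 + 162 * Real.exp 1 * σ) := Real.sqrt_pos.mpr hpos
  rw [le_div_iff₀ hspos]
  nlinarith [Real.sqrt_nonneg 2]

/-- Case (2) of the profile inequality: `1/√(2eσ) ≤ 9√2/√(1+162eσ)` once `162 e σ ≥ 1`. -/
theorem inv_sqrt_le_profile {σ : ℝ} (h : 1 ≤ 162 * Real.exp 1 * σ) :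
    (Real.sqrt (2 * Real.exp 1 * σ))⁻¹ ≤ 9 * Real.sqrt 2 / Real.sqrt (1 + 162 * Real.exp 1 * σ) := by
  have he : 0 < Real.exp 1 := Real.exp_pos 1
  have hσ : 0 < σ := by
    by_contra hneg
    push Not at hneg
    nlinarith
  have hA : 0 < 2 * Real.exp 1 * σ := by positivity
  have hB : 0 < 1 + 162 * Real.exp 1 * σ := by positivity
  have hsA : 0 < Real.sqrt (2 * Real.exp 1 * σ) := Real.sqrt_pos.mpr hA
  have hsB : 0 < Real.sqrt (1 + 162 * Real.exp 1 * σ) := Real.sqrt_pos.mpr hB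
  rw [inv_le_comm₀ hsA (by positivity), inv_div, div_le_iff₀ (by positivity)]
  -- goal: √(1+162eσ) ≤ √(2eσ) * (9 * √2)
  have hsq : Real.sqrt (2 * Real.exp 1 * σ) * (9 * Real.sqrt 2) = Real.sqrt (324 * Real.exp 1 * σ) := by
    have h2 : (9 : ℝ) * Real.sqrt 2 = Real.sqrt 162 := by
      rw [show (162 : ℝ) = 9 ^ 2 * 2 by norm_num, Real.sqrt_mul (by norm_num), Real.sqrt_sq (by norm_num)]
    rw [h2, ← Real.sqrt_mul hA.le]
    congr 1; ring
  rw [hsq]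
  exact Real.sqrt_le_sqrt (by linarith)

/-- **Merged smoothing profile for the Wilson heat semigroup**: for every `σ ≥ 0`, `m ∈ [-1/2,1]` and every
vector `u`, `‖exp(-σ D_Wᴴ D_W) D_Wᴴ u‖₂ ≤ (9√2/√(1 + 162 e σ)) ‖u‖₂` — for `162eσ ≤ 1` this is the contraction
times `‖D_Wᴴ‖ ≤ 9`, for `162eσ ≥ 1` it is adjoint smoothing `(2eσ)^{-1/2}`.  The profile is continuous on
`[0, ∞)`, which is what Minkowski's inequality for the Duhamel column needs at the endpoint `σ = 0`. -/
theorem combined_smoothing (U : GaugeConfig 4 L (Matrix.specialUnitaryGroup (Fin 3) ℂ)) {m : ℝ}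
    (hm : m ∈ Set.Icc (-(1 / 2 : ℝ)) 1) {σ : ℝ} (hσ : 0 ≤ σ) (u : TorusSite 4 L × Fin 3 × Fin 4 → ℂ) :
    Real.sqrt (∑ i, ‖((NormedSpace.exp (-(σ : ℂ) • ((wilsonDirac (fundamentalRep (Fin 3)) U m 1)ᴴ *
        wilsonDirac (fundamentalRep (Fin 3)) U m 1)) * (wilsonDirac (fundamentalRep (Fin 3)) U m 1)ᴴ).mulVec u) i‖ ^ 2) ≤
      9 * Real.sqrt 2 / Real.sqrt (1 + 162 * Real.exp 1 * σ) * Real.sqrt (∑ i, ‖u i‖ ^ 2) := by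
  set D := wilsonDirac (fundamentalRep (Fin 3)) U m 1 with hD
  have hu0 : 0 ≤ ∑ i, ‖u i‖ ^ 2 := Finset.sum_nonneg fun i _ => by positivity
  by_cases hcase : 162 * Real.exp 1 * σ ≤ 1
  · -- contraction after `‖Dᴴ u‖₂ ≤ 9 ‖u‖₂`
    have h1 : ∑ i, ‖((NormedSpace.exp (-(σ : ℂ) • (Dᴴ * D)) * Dᴴ).mulVec u) i‖ ^ 2 ≤
        81 * ∑ i, ‖u i‖ ^ 2 := by
      rw [← Matrix.mulVec_mulVec]
      exact (heat_mulVec_contraction D hσ _).trans (sum_norm_sq_conjTranspose_wilsonDirac_mulVec_le U hm u)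
    calc Real.sqrt (∑ i, ‖((NormedSpace.exp (-(σ : ℂ) • (Dᴴ * D)) * Dᴴ).mulVec u) i‖ ^ 2)
        ≤ Real.sqrt (81 * ∑ i, ‖u i‖ ^ 2) := Real.sqrt_le_sqrt h1
      _ = 9 * Real.sqrt (∑ i, ‖u i‖ ^ 2) := by
          rw [Real.sqrt_mul (by norm_num), show (81 : ℝ) = 9 ^ 2 by norm_num, Real.sqrt_sq (by norm_num)]
      _ ≤ 9 * Real.sqrt 2 / Real.sqrt (1 + 162 * Real.exp 1 * σ) * Real.sqrt (∑ i, ‖u i‖ ^ 2) :=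
          mul_le_mul_of_nonneg_right (nine_le_profile hσ hcase) (Real.sqrt_nonneg _)
  · push Not at hcase
    have hσ0 : 0 < σ := by
      by_contra hneg; push Not at hneg
      have : σ = 0 := le_antisymm hneg hσ
      rw [this, mul_zero] at hcase; linarith
    have h1 := adjoint_smoothing D hσ0 u
    have hA : 0 < 2 * Real.exp 1 * σ := by positivity
    calc Real.sqrt (∑ i, ‖((NormedSpace.exp (-(σ : ℂ) • (Dᴴ * D)) * Dᴴ).mulVec u) i‖ ^ 2)
        ≤ Real.sqrt ((2 * Real.exp 1 * σ)⁻¹ * ∑ i, ‖u i‖ ^ 2) := Real.sqrt_le_sqrt h1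
      _ = (Real.sqrt (2 * Real.exp 1 * σ))⁻¹ * Real.sqrt (∑ i, ‖u i‖ ^ 2) := by
          rw [Real.sqrt_mul (inv_nonneg.mpr hA.le), Real.sqrt_inv]
      _ ≤ 9 * Real.sqrt 2 / Real.sqrt (1 + 162 * Real.exp 1 * σ) * Real.sqrt (∑ i, ‖u i‖ ^ 2) :=
          mul_le_mul_of_nonneg_right (inv_sqrt_le_profile hcase.le) (Real.sqrt_nonneg _)


/-- **Registered form (stub `stub_combinedSmoothing` of the crux item)**: the merged smoothing profile for the Wilson heat
semigroup, `‖exp(-σ D_Wᴴ D_W) D_Wᴴ u‖₂ ≤ (9√2/√(1 + 162 e σ)) ‖u‖₂` for all `σ ≥ 0`, `m ∈ [-1/2,1]` (`combined_smoothing`). -/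
theorem stub_combinedSmoothing :
    ∀ (L : ℕ) [NeZero L] (U : GaugeConfig 4 L (Matrix.specialUnitaryGroup (Fin 3) ℂ)) (m : ℝ),
      m ∈ Set.Icc (-(1 / 2 : ℝ)) 1 → ∀ (σ : ℝ), 0 ≤ σ → ∀ (u : TorusSite 4 L × Fin 3 × Fin 4 → ℂ),
        Real.sqrt (∑ i, ‖((NormedSpace.exp (-(σ : ℂ) • ((wilsonDirac (fundamentalRep (Fin 3)) U m 1)ᴴ *
            wilsonDirac (fundamentalRep (Fin 3)) U m 1)) * (wilsonDirac (fundamentalRep (Fin 3)) U m 1)ᴴ).mulVec u) i‖ ^ 2) ≤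
          9 * Real.sqrt 2 / Real.sqrt (1 + 162 * Real.exp 1 * σ) * Real.sqrt (∑ i, ‖u i‖ ^ 2) :=
  fun _ _ U _ hm _ hσ u => combined_smoothing U hm hσ u

end Wilson

end Summit.QuantumFields.QCD.Cruxes.InterleavedHeatSliceFlow.Sketch

end
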